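import Summits.AtomisticToContinuum.Crystallization.Theorems.CoarseGrains.Negative.RadiusVacuity
import Summits.AtomisticToContinuum.Crystallization.Theorems.CoarseGrains.Negative.LoadBearing

/-!
# `CoarseGrains` / Negative: covering radius `≤ 4/5` — the radius quantifier carries content from `R ≥ 4/5`

Negative knowledge for crux `stmt-AtomisticToContinuum-9331` (`ExcessDecayLiouville.CoarseGrains`),
standing crux-disprover seat `refuter-cdisprove-stmt-AtomisticToContinuum-9331-g2-0` (cycle 2,
2026-08-16); builds on `Negative.PredicateAPI`, `Negative.RadiusVacuity`, `Negative.LoadBearing`;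
companion of `Negative.VacuityThreshold` (`R ≤ 7/10` is vacuous).  Nothing here closes an item; no
theorem concludes a Theses decl.

* `exists_site_near_two`: every point of `ℝ³` is within `4/5` of a site `t m + A z` of ANY admissible
  datum with hcp-like inner displacement — pull back through `A` (onto), round the height to the
  nearest layer of the unit hcp stacking (A-layer `Λ` or B-layer `w + √(2/3)e₃ + Λ`), round in-plane by
  coordinates; the error has `|·₀| ≤ 1/2`, `|·₁| ≤ √3/4`, `|·₂| ≤ √(2/3)/2`, norm² `≤ 29/48`; push forward
  (`‖A‖ ≤ 199/200`) and add the `Inner` tolerance `1/40`: `(199/200)√(29/48) + 1/40 < 4/5`.  Sharpens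
  `PredicateAPI.exists_site_near` (`11/10`, sublattice `0` only).
* `not_near_empty` / `coarseGrains_matrix_fails_empty` / `one_le_threshold`: for `R ≥ 4/5` the matrix
  of the crux FAILS for the empty ground state, so `N₀(R) ≥ 1` is forced there.
* `succ_le_card_of_near_two` / `coarseGrains_threshold_lower_bound_two`: a matched ball of radius
  `4/5 + K` needs `K + 1` particles; `N₀(R) > R − 9/5` (sharpens `LoadBearing`'s `R − 21/10`).
-/

noncomputable section

open Literature.MathematicalPhysics.StatisticalMechanics

namespace Summit.AtomisticToContinuum.Crystallization.Theorems.CoarseGrains.Negative.CoveringRadius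

open Summit.AtomisticToContinuum.Crystallization.Theorems.CoarseGrains.Negative.PredicateAPI
open Summit.AtomisticToContinuum.Crystallization.Theorems.CoarseGrains.Negative.RadiusVacuity
open Summit.AtomisticToContinuum.Crystallization.Theorems.CoarseGrains.Negative.LoadBearing

/-! ### Not vacuous from `R ≥ 4/5`: every point is within `4/5` of a site of any admissible datum

Two-sublattice rounding: pull the point back through `A` (onto), round the height to the nearest
layer of the unit hcp stacking (A-layer: `Λ`; B-layer: `w + √(2/3)e₃ + Λ`), round in-plane in the
triangular lattice by coordinates; the error vector has `|·₀| ≤ 1/2`, `|·₁| ≤ √3/4`, `|·₂| ≤ √(2/3)/2`,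
so norm² `≤ 29/48`; push forward (`‖A‖ ≤ 199/200`) and add the `Inner` tolerance `1/40` on the
B-sublattice: `(199/200)√(29/48) + 1/40 < 4/5`.  (The true covering radius of an admissible site set is
`≈ 0.70–0.72`: octahedral holes.) -/

/-- In-plane rounding in the triangular lattice by coordinates. [folklore] -/
theorem exists_int_inplane (q0 q1 : ℝ) :
    ∃ i j : ℤ, |q0 - ((i : ℝ) + j / 2)| ≤ 1 / 2 ∧ |q1 - (j : ℝ) * (Real.sqrt 3 / 2)| ≤ Real.sqrt 3 / 4 := by
  set s : ℝ := Real.sqrt 3 / 2 with hs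
  have hspos : 0 < s := by rw [hs]; positivity
  set j : ℤ := round (q1 / s) with hj
  set i : ℤ := round (q0 - j / 2) with hi
  refine ⟨i, j, ?_, ?_⟩
  · have := abs_sub_round (q0 - (j : ℝ) / 2)
    rw [← hi] at this
    have e : q0 - ((i : ℝ) + j / 2) = (q0 - j / 2) - i := by ring
    rw [e]; exact this
  · have h1 := abs_sub_round (q1 / s)
    rw [← hj] at h1
    have e : q1 - (j : ℝ) * s = s * (q1 / s - j) := by field_simp
    rw [e, abs_mul, abs_of_pos hspos]
    have : s * |q1 / s - (j : ℝ)| ≤ s * (1 / 2) := mul_le_mul_of_nonneg_left h1 hspos.le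
    have e2 : Real.sqrt 3 / 4 = s * (1 / 2) := by rw [hs]; ring
    rw [e2]; exact this

/-- Norm bound from the three coordinate bounds of the rounding error. [folklore] -/
theorem norm_sq_le_of_coord_bounds (w : E3) (h0 : |w 0| ≤ 1 / 2) (h1 : |w 1| ≤ Real.sqrt 3 / 4)
    (h2 : |w 2| ≤ Real.sqrt (2 / 3) / 2) : ‖w‖ ^ 2 ≤ 29 / 48 := by
  have hn : ‖w‖ ^ 2 = w 0 ^ 2 + w 1 ^ 2 + w 2 ^ 2 := by
    rw [EuclideanSpace.norm_eq, Real.sq_sqrt (by positivity), Fin.sum_univ_three]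
    simp [Real.norm_eq_abs, sq_abs]
  have a0 : w 0 ^ 2 ≤ (1 / 2) ^ 2 := sq_le_sq' (abs_le.1 h0).1 (abs_le.1 h0).2
  have a1 : w 1 ^ 2 ≤ (Real.sqrt 3 / 4) ^ 2 := sq_le_sq' (abs_le.1 h1).1 (abs_le.1 h1).2
  have a2 : w 2 ^ 2 ≤ (Real.sqrt (2 / 3) / 2) ^ 2 := sq_le_sq' (abs_le.1 h2).1 (abs_le.1 h2).2
  rw [div_pow, Real.sq_sqrt (show (0 : ℝ) ≤ 3 by norm_num)] at a1
  rw [div_pow, sqrt23_sq] at a2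
  rw [hn]; linarith

/-- `2√(2/3) > 0`. -/
theorem layer_period_pos : (0 : ℝ) < 2 * Real.sqrt (2 / 3) := by positivity

/-- **Covering radius `≤ 4/5`.** Every point of `ℝ³` is within `4/5` of a site `t m + A z` (`z ∈ Λ`,
`m ∈ {0,1}`) of ANY admissible datum with hcp-like inner displacement (sharpens
`PredicateAPI.exists_site_near`, `11/10`, which used sublattice `0` only). [folklore] -/
theorem exists_site_near_two {A : E3 →L[ℝ] E3} (hA : Adm A) {t : Fin 2 → E3} (ht : Inner t A)
    (c : E3) : ∃ m : Fin 2, ∃ z ∈ Lam, dist (t m + A z) c ≤ 4 / 5 := by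
  obtain ⟨y, hy⟩ := adm_surjective hA (c - t 0)
  set c₃ : ℝ := 2 * Real.sqrt (2 / 3) with hc₃
  have hc₃pos : 0 < c₃ := layer_period_pos
  set n : ℤ := round (y 2 / c₃) with hn
  set δ : ℝ := y 2 / c₃ - n with hδ
  have hδabs : |δ| ≤ 1 / 2 := by rw [hδ, hn]; exact abs_sub_round _
  have hy2 : y 2 = c₃ * (n + δ) := by rw [hδ]; field_simp; ring
  set off : E3 := barlowOffset 1 + layerNormal (Real.sqrt (2 / 3)) with hoff
  have ho0 : off 0 = 1 / 2 := by simp [hoff, barlowOffset, layerNormal]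
  have ho1 : off 1 = Real.sqrt 3 / 6 := by simp [hoff, barlowOffset, layerNormal]
  have ho2 : off 2 = Real.sqrt (2 / 3) := by simp [hoff, barlowOffset, layerNormal]
  -- the push-forward estimate, shared by the three cases
  have push : ∀ w : E3, ‖w‖ ^ 2 ≤ 29 / 48 → ‖A w‖ ≤ 31 / 40 := by
    intro w hw
    have h1 := adm_norm_le hA w
    have h2 : ‖w‖ ≤ 31 * 200 / (40 * 199) := by
      nlinarith [norm_nonneg w, hw, sq_nonneg (‖w‖ - 31 * 200 / (40 * 199))]
    linarith
  by_cases hA0 : |δ| ≤ 1 / 4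
  · -- A-layer `n`
    obtain ⟨i, j, hi, hj⟩ := exists_int_inplane (y 0) (y 1)
    refine ⟨0, _, mem_lam i j n, ?_⟩
    set zz : E3 := (i : ℝ) • triangularVec₁ 1 + (j : ℝ) • triangularVec₂ 1 +
      (n : ℝ) • layerNormal (2 * Real.sqrt (2 / 3)) with hzz
    obtain ⟨h0, h1, h2⟩ := lamVec_apply (i : ℝ) j n
    have e : t 0 + A zz - c = A (zz - y) := by rw [map_sub, hy]; abel
    have w0 : |(zz - y) 0| ≤ 1 / 2 := by
      rw [PiLp.sub_apply, h0, abs_sub_comm]; exact hi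
    have w1 : |(zz - y) 1| ≤ Real.sqrt 3 / 4 := by
      rw [PiLp.sub_apply, h1, abs_sub_comm]; exact hj
    have w2 : |(zz - y) 2| ≤ Real.sqrt (2 / 3) / 2 := by
      rw [PiLp.sub_apply, h2, hy2]
      have e2 : (n : ℝ) * (2 * Real.sqrt (2 / 3)) - c₃ * (n + δ) = -(c₃ * δ) := by rw [hc₃]; ring
      rw [e2, abs_neg, abs_mul, abs_of_pos hc₃pos, hc₃]
      nlinarith [Real.sqrt_nonneg (2 / 3 : ℝ), abs_nonneg δ]
    rw [dist_eq_norm, e]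
    linarith [push _ (norm_sq_le_of_coord_bounds _ w0 w1 w2)]
  · -- B-layer: index `n` if `δ > 1/4`, index `n - 1` if `δ < -1/4`
    have hsplit : 1 / 4 < δ ∨ δ < -(1 / 4) := by
      rcases lt_or_gt_of_ne (show |δ| ≠ 1 / 4 from fun h => hA0 h.le) with h | h
      · exact absurd h.le hA0
      · rcases le_or_gt 0 δ with hd | hd
        · left; rwa [abs_of_nonneg hd] at h
        · right; rw [abs_of_neg hd] at h; linarith
    obtain ⟨i, j, hi, hj⟩ := exists_int_inplane (y 0 - 1 / 2) (y 1 - Real.sqrt 3 / 6)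
    -- the layer index
    obtain ⟨n', hn'⟩ : ∃ n' : ℤ, |Real.sqrt (2 / 3) + (n' : ℝ) * (2 * Real.sqrt (2 / 3)) - y 2| ≤
        Real.sqrt (2 / 3) / 2 := by
      rcases hsplit with hd | hd
      · refine ⟨n, ?_⟩
        have e2 : Real.sqrt (2 / 3) + (n : ℝ) * (2 * Real.sqrt (2 / 3)) - y 2 =
            c₃ * (1 / 2 - δ) := by rw [hy2, hc₃]; ring
        rw [e2, abs_mul, abs_of_pos hc₃pos, hc₃, abs_of_nonneg (by linarith [abs_le.1 hδabs])]
        nlinarith [Real.sqrt_nonneg (2 / 3 : ℝ), (abs_le.1 hδabs).2]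
      · refine ⟨n - 1, ?_⟩
        have e2 : Real.sqrt (2 / 3) + ((n - 1 : ℤ) : ℝ) * (2 * Real.sqrt (2 / 3)) - y 2 =
            c₃ * (-(1 / 2) - δ) := by push_cast; rw [hy2, hc₃]; ring
        rw [e2, abs_mul, abs_of_pos hc₃pos, hc₃]
        have : |-(1 / 2) - δ| ≤ 1 / 4 := by
          rw [abs_le]; constructor <;> linarith [(abs_le.1 hδabs).1]
        nlinarith [Real.sqrt_nonneg (2 / 3 : ℝ), this]
    refine ⟨1, _, mem_lam i j n', ?_⟩
    set zz : E3 := (i : ℝ) • triangularVec₁ 1 + (j : ℝ) • triangularVec₂ 1 +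
      (n' : ℝ) • layerNormal (2 * Real.sqrt (2 / 3)) with hzz
    obtain ⟨h0, h1, h2⟩ := lamVec_apply (i : ℝ) j n'
    have e : t 1 + A zz - c = (t 1 - t 0 - A off) + A (off + zz - y) := by
      have hlin : A (off + zz - y) = A off + A zz - A y := by simp only [map_sub, map_add]
      rw [hlin, hy]; abel
    have w0 : |(off + zz - y) 0| ≤ 1 / 2 := by
      rw [PiLp.sub_apply, PiLp.add_apply, h0, ho0]
      have e0 : 1 / 2 + ((i : ℝ) + j / 2) - y 0 = -((y 0 - 1 / 2) - ((i : ℝ) + j / 2)) := by ring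
      rw [e0, abs_neg]; exact hi
    have w1 : |(off + zz - y) 1| ≤ Real.sqrt 3 / 4 := by
      rw [PiLp.sub_apply, PiLp.add_apply, h1, ho1]
      have e1 : Real.sqrt 3 / 6 + (j : ℝ) * (Real.sqrt 3 / 2) - y 1 =
          -((y 1 - Real.sqrt 3 / 6) - (j : ℝ) * (Real.sqrt 3 / 2)) := by ring
      rw [e1, abs_neg]; exact hj
    have w2 : |(off + zz - y) 2| ≤ Real.sqrt (2 / 3) / 2 := by
      rw [PiLp.sub_apply, PiLp.add_apply, h2, ho2]; exact hn'
    have hIn : ‖t 1 - t 0 - A off‖ ≤ 1 / 40 := ht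
    rw [dist_eq_norm, e]
    calc ‖(t 1 - t 0 - A off) + A (off + zz - y)‖
        ≤ ‖t 1 - t 0 - A off‖ + ‖A (off + zz - y)‖ := norm_add_le _ _
      _ ≤ 1 / 40 + 31 / 40 := by
          gcongr
          exact push _ (norm_sq_le_of_coord_bounds _ w0 w1 w2)
      _ = 4 / 5 := by norm_num

/-- Hence for `R ≥ 4/5` the matching is NOT vacuous: the empty configuration has no datum
(some site lies in the ball and owns no particle). [folklore] -/
theorem not_near_empty {A : E3 →L[ℝ] E3} (hA : Adm A) {t : Fin 2 → E3} (ht : Inner t A) {c : E3}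
    {R : ℝ} (hR : 4 / 5 ≤ R) : ¬ Near (∅ : Set E3) c R t A (1 / 40) := by
  intro hN
  obtain ⟨m, z, hz, hzc⟩ := exists_site_near_two hA ht c
  obtain ⟨p, hp, -⟩ := hN.2 m z hz (le_trans hzc hR)
  exact hp

/-- **The vacuity threshold is below `4/5`:** at every radius `R ≥ 4/5` the matrix of `CoarseGrains`
FAILS for the empty ground state, so `N₀(R) ≥ 1` is forced (compare `near_trivial_of_le`: for
`R ≤ 7/10` it holds for every configuration).  The exact threshold is the supremum over admissible
data of the covering radius of the site set, `≈ 0.70–0.72` (octahedral holes of the dilated /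
`Inner`-shifted two-lattice). [folklore] -/
theorem coarseGrains_matrix_fails_empty {R : ℝ} (hR : 4 / 5 ≤ R) (x : Fin 0 → E3) :
    ¬ ∃ (c : E3) (t : Fin 2 → E3) (A : E3 →L[ℝ] E3), Adm A ∧ Inner t A ∧
      Near (Set.range x) c R t A (1 / 40) := by
  rintro ⟨c, t, A, hA, ht, hN⟩
  have hr : Set.range x = ∅ := Set.range_eq_empty x
  rw [hr] at hN
  exact not_near_empty hA ht hR hN

/-- Quantitative form: any threshold `N₀` valid at a radius `R ≥ 4/5` is at least `1` (the empty
configuration is a ground state, `LoadBearing.isGroundState_fin_zero`). [folklore] -/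
theorem one_le_threshold {R : ℝ} (hR : 4 / 5 ≤ R) {N₀ : ℕ}
    (h : ∀ N : ℕ, N₀ ≤ N → ∀ x : Fin N → E3, IsGroundState lennardJones x →
      ∃ (c : E3) (t : Fin 2 → E3) (A : E3 →L[ℝ] E3), Adm A ∧ Inner t A ∧
        Near (Set.range x) c R t A (1 / 40)) :
    1 ≤ N₀ := by
  by_contra h0
  push Not at h0
  have hN0 : N₀ = 0 := by omega
  have := h 0 (by omega) (fun i => i.elim0) (isGroundState_fin_zero _)
  exact coarseGrains_matrix_fails_empty hR _ this

/-! ### Counting from either sublattice: a matched ball of radius `4/5 + K` needs `K + 1` particles -/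

/-- Sharpening of `LoadBearing.succ_le_card_of_near` (`11/10 + K`): if `B_R(c)` is two-way
`1/40`-matched, `Inner` holds and `4/5 + K ≤ R`, the configuration has at least `K + 1` particles —
march `K` steps along `A u` from the site within `4/5` of `c`, on whichever sublattice it lies.
[folklore] -/
theorem succ_le_card_of_near_two {N : ℕ} {x : Fin N → E3} {c : E3} {R : ℝ} {t : Fin 2 → E3}
    {A : E3 →L[ℝ] E3} (hA : Adm A) (ht : Inner t A) (hN : Near (Set.range x) c R t A (1 / 40))
    (K : ℕ) (hR : 4 / 5 + K ≤ R) : K + 1 ≤ N := by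
  obtain ⟨m, z₀, hz₀, hz₀c⟩ := exists_site_near_two hA ht c
  set u : E3 := triangularVec₁ 1 with hu
  have hAu : ‖A u‖ ≤ 199 / 200 := by simpa [hu, norm_triangularVec₁] using adm_norm_le hA u
  let s : Fin (K + 1) → E3 := fun n => t m + A (z₀ + ((n : ℕ) : ℝ) • u)
  have hs_mem : ∀ n : Fin (K + 1), z₀ + ((n : ℕ) : ℝ) • u ∈ Lam := fun n =>
    lam_add_mem hz₀ (lam_nsmul_mem n triangularVec₁_mem_lam)
  have hs_ball : ∀ n : Fin (K + 1), dist (s n) c ≤ R := by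
    intro n
    have hn : ((n : ℕ) : ℝ) ≤ K := by exact_mod_cast Nat.lt_succ_iff.1 n.2
    have h1 : dist (s n) (t m + A z₀) = ‖A (((n : ℕ) : ℝ) • u)‖ := by
      rw [dist_site_site]; congr 1; abel_nf
    have h2 : ‖A (((n : ℕ) : ℝ) • u)‖ ≤ (n : ℕ) * (199 / 200) := by
      rw [map_smul, norm_smul, Real.norm_eq_abs, abs_of_nonneg (by positivity)]
      exact mul_le_mul_of_nonneg_left hAu (by positivity)
    calc dist (s n) c ≤ dist (s n) (t m + A z₀) + dist (t m + A z₀) c := dist_triangle _ _ _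
      _ ≤ (n : ℕ) * (199 / 200) + 4 / 5 := by rw [h1]; linarith
      _ ≤ R := by nlinarith
  have hown : ∀ n : Fin (K + 1), ∃ i : Fin N, dist (x i) (s n) ≤ 1 / 40 := by
    intro n
    obtain ⟨p, ⟨i, rfl⟩, hp⟩ := hN.2 m _ (hs_mem n) (hs_ball n)
    exact ⟨i, hp⟩
  choose f hf using hown
  have hinj : Function.Injective f := by
    intro n n' hnn
    by_contra hne
    have hne' : (z₀ + ((n : ℕ) : ℝ) • u) ≠ z₀ + ((n' : ℕ) : ℝ) • u := by
      intro h
      have h' : ((n : ℕ) : ℝ) • u = ((n' : ℕ) : ℝ) • u := add_left_cancel h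
      have hu0 : u ≠ 0 := by
        intro h0; have := norm_triangularVec₁; rw [← hu, h0, norm_zero] at this; norm_num at this
      have := smul_left_injective ℝ hu0 h'
      exact hne (Fin.ext (by exact_mod_cast this))
    have hfar := le_dist_site_of_ne hA (t m) (hs_mem n) (hs_mem n') hne'
    have hclose : dist (s n) (s n') ≤ 1 / 40 + 1 / 40 := by
      calc dist (s n) (s n') ≤ dist (s n) (x (f n)) + dist (x (f n)) (s n') := dist_triangle _ _ _
        _ ≤ 1 / 40 + 1 / 40 := by
          gcongr
          · rw [dist_comm]; exact hf n
          · rw [hnn]; exact hf n'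
    change 189 / 200 ≤ dist (s n) (s n') at hfar
    linarith
  simpa using Fintype.card_le_of_injective f hinj

/-- Hence `N₀(R) > R − 4/5 − 1 = R − 9/5` in any proof of the crux (ground states of every size exist),
sharpening `LoadBearing.coarseGrains_threshold_lower_bound` (`R − 21/10`). [folklore] -/
theorem coarseGrains_threshold_lower_bound_two {R : ℝ} {N₀ : ℕ}
    (h : ∀ N : ℕ, N₀ ≤ N → ∀ x : Fin N → E3, IsGroundState lennardJones x →
      ∃ (c : E3) (t : Fin 2 → E3) (A : E3 →L[ℝ] E3), Adm A ∧ Inner t A ∧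
        Near (Set.range x) c R t A (1 / 40)) :
    R - 4 / 5 < N₀ := by
  by_contra hR
  push Not at hR
  obtain ⟨x, hx⟩ := LennardJonesGroundStatesExist_holds N₀
  obtain ⟨c, t, A, hA, ht, hN⟩ := h N₀ le_rfl x hx
  have := succ_le_card_of_near_two hA ht hN N₀ (by linarith)
  omega

end Summit.AtomisticToContinuum.Crystallization.Theorems.CoarseGrains.Negative.CoveringRadius

end
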